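import Mathlib
import Literature.NumberTheory.Transcendental.PeriodsWave0
import Literature.NumberTheory.Irrationality.Brown2016.DinnerParties
import Literature.NumberTheory.Irrationality.BrownZudilin2022.CellularZetaFive
import Literature.NumberTheory.Irrationality.BrownZudilin2022.GeneralFamily
import Summits.KontsevichZagierPeriods.Zeta5Search.Families.CellularIntegral
import HarnessLib

/-!
# ζ(5) search — Families: middle-weight laws for the N = 8 generalised cellular families (STAGED statements, fam-brown8 gen 3)

HONEST FRAMING: systematic search; no irrationality claim unless certified.  This file only STATES `Prop`s; nothing is
asserted.  Each `def … : Prop` is an exact law supported by (a) PRINTED theorems — Brown, arXiv:1412.6508, Thm 8.1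
(convergent generalised cellular integrals on `M_{0,8}` are ℚ-linear combinations of MZVs of weight ≤ 5, via motivic
periods of the mixed Tate motive `m(A,B) = H⁵(M̄_{0,8} ∖ A, B ∖ A)`) and Cor. 8.2 (`gr^W_{2m} m(A,B) = 0` ⇒ no weight-`m`
part) — and (b) a FINITE COMPUTATION of weight-graded dimensions of `m(A,B)` (HOME `families/brown8/census/mw/`,
engine `pub-zeta5-fam-brown8/g3/mw_engine.py`: the E₂ = E_∞ page of the weight spectral sequence of the pair, Keel
presentation of the strata, exact-zero-certified linear algebra mod p; validated eight ways, NOT kernel-checked).  Status of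
every law: THEOREM-BY-COMPUTATION modulo the correctness of that engine; typed here for the filing lane, which decides
whether/how to land them (e.g. as `@[conjecture]`-tagged statements with the evidence pointer, or behind a named-fact
hypothesis recording the computed dimensions).  Parametrisation as in `Families/CellularIntegral.lean`: `σ = ofSeating s`
for the 17 seating plans `s ∈ Brown2016.reps8`, `a i` = exponent of the `δ`-edge `{i,i+1}`, `b i` = exponent of the `σ`-edge
`{σ i, σ (i+1)}`, `Homogeneous` = Brown's (5.2), `BrownConvergent` = the 20 arc valuations `≥ 0`.
-/

noncomputable section

namespace Summit.KontsevichZagierPeriods.Zeta5Search.Families.Cellular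

open Literature.NumberTheory.Transcendental (zetaValue)
open Literature.NumberTheory.Irrationality

/-- **Envelope law** for a seating plan `σ` of 8 guests: there is ONE weight-5 number `θ_σ = u ζ(5) + v ζ(3)ζ(2)` (`u, v ∈ ℚ`
depending only on `σ`) such that EVERY convergent member of the generalised cellular family of `σ` (any integer exponents on
Brown's homogeneity lattice satisfying the convergence condition) is a ℚ-linear combination of `1, ζ(2), ζ(3), θ_σ` — in
particular no `ζ(4)` and no second weight-5 direction ever occurs.  EVIDENCE (census/mw, `amax.json` + `profiles8.jsonl` mode
`amax-cone`): the polar locus of every member lies in the exact-LP envelope `A_max(σ)` (divisors whose valuation form is negative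
somewhere on the rational convergence polyhedron), and `dim gr^W_{2w} H⁵(M̄_{0,8} ∖ A_max(σ), δ⁰ ∖ A_max(σ))` for `w = 0,…,5` is
`(1, 0, *, *, 0, 1)`; then [Brown2016, Thm 8.1, Cor. 8.2] and the weight-grading of motivic MZVs give the law (the weight-5 component
of the motivic period lies on the line spanned by the period of a generator of the 1-dimensional `gr^W_{10}`).  Computed (gen 3,
2026-08-21) for ALL 17 convergent configurations: profile `(1, 0, 1, h₃, 0, 1)` with `h₃ = 4` (₈π₈^∨ = BZ), `8` (₈π₈), `9–17` (the
other 15) — table in census/mw/STATEMENTS.md §A; computed zeros are exact (𝔽_p upper bounds), the engine is validated but not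
kernel-checked, so this is a THEOREM-BY-COMPUTATION recorded as a statement: the `def` below asserts nothing. -/
def EnvelopeLaw (σ : Fin 8 → Fin 8) : Prop :=
  ∃ u v : ℚ, ∀ a b : Fin 8 → ℤ, Homogeneous σ a b → BrownConvergent σ a b →
    ∃ q₀ q₂ q₃ Q : ℚ,
      integral σ a b = q₀ + q₂ * zetaValue 2 + q₃ * zetaValue 3 + Q * (u * zetaValue 5 + v * (zetaValue 3 * zetaValue 2))

/-- The weaker **no-ζ(4) law** (weights `{0,2,3,5}` only, without the rank-one statement in weight 5). -/
def NoWeightFourLaw (σ : Fin 8 → Fin 8) : Prop :=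
  ∀ a b : Fin 8 → ℤ, Homogeneous σ a b → BrownConvergent σ a b →
    ∃ q₀ q₂ q₃ q₅ q₃₂ : ℚ,
      integral σ a b = q₀ + q₂ * zetaValue 2 + q₃ * zetaValue 3 + q₅ * zetaValue 5 + q₃₂ * (zetaValue 3 * zetaValue 2)

/-- The envelope law for all 17 convergent configurations of 8 guests (`Brown2016.reps8`). -/
@[conjecture] def EnvelopeLawAll8 : Prop :=
  ∀ s ∈ Brown2016.reps8, EnvelopeLaw (ofSeating (ℓ := 5) s)

/-- **Weight-certified ζ(3)-free sub-cone of the Brown–Zudilin family** (`₈π₈^∨ = (8,2,4,1,7,5,3,6)`, BZ coordinates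
`a ∈ ℤ⁸` of [BrownZudilin2022, (1)–(3)]).  `twoValBZ a` lists TWICE the valuations `v_D(a)` of the integrand of (1) along those of the 60
boundary divisors `D` of `M̄_{0,8}` that are neither at finite distance for `δ`, nor for `σ`, nor polar for the basic (totally
symmetric) member; `PolarWithinBasic a` says none of them is polar.  That sub-cone turns out to be THIN (`polarWithinBasic_shape`: the basic ray and one companion ray); on it the integral is a period of the single motive
`m(A_basic, δ⁰)` whose `gr^W_6` VANISHES (census/mw: profile `(1,0,1,0,0,1)`, `|A_basic| = 39`), so by [Brown2016, Cor. 8.2] it is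
ζ(3)-free: `I(a) ∈ ℚ θ + ℚ ζ(2) + ℚ`, `θ = 2ζ(5)+4ζ(3)ζ(2)`.  NOT NEW as a statement — it is implied by BZ's decomposition (4)
(`BrownZudilin2022.decomposition`, all convergent `a`); what the computation adds is the MOTIVIC REASON on this sub-cone.  Off the
sub-cone the polar motive of a chamber CAN have `gr^W_6 ≠ 0` (census/mw `bz_noncert.jsonl`), but since Brown's Thm 8.1 allows any
divisor set `A ⊇ Sing(η)` and `gr^W_6` is not monotone in `A`, much larger certified regions exist: see `PolarWithinXStar` below.
Of the 60 divisors, 12 have identically vanishing valuation (order 0 for every `a`) and are omitted; the 48 affine forms are generated from the valuation calculus (`gsat.py`, asserted against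
`BrownZudilin2022.Converges` on a box). -/
def twoValBZ (a : Fin 8 → ℤ) : List ℤ :=
  [2 * a 0 + 2,
    2 * a 0 + 2,
    -2 * a 1 + 2 * a 3 - 2 * a 5 + 2 * a 7,
    2 * a 1 + 2 * a 2 - 2 * a 3 + 2 * a 5 - 2 * a 6 - 2 * a 7,
    2 * a 1 + 2 * a 5 - 2 * a 6 - 2 * a 7,
    2 * a 4 + 2,
    -2 * a 0 - 2 * a 1 + 2 * a 3 + 2 * a 7,
    -2 * a 2 + 2 * a 7,
    2 * a 1 - 2 * a 7,
    2 * a 1 + 2,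
    -2 * a 1 - 2 * a 2 + 2 * a 3 - 2 * a 5 + 2 * a 6 + 2 * a 7,
    2 * a 4 + 2,
    2 * a 5 + 2,
    2 * a 2 - 2 * a 7,
    2 * a 2 + 2,
    2 * a 5 - 2 * a 7,
    2 * a 1 + 2 * a 2 - 2 * a 4 - 2 * a 7,
    2 * a 5 + 2,
    2 * a 0 - 2 * a 2 + 2 * a 7 + 2,
    2 * a 0 + 2 * a 1 - 2 * a 7 + 2,
    2 * a 3 - 2 * a 5 + 2 * a 7 + 2,
    2 * a 0 - 2 * a 2,
    2 * a 0 + 2 * a 4 + 4,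
    -2 * a 1 + 2 * a 3 + 2 * a 7 + 2,
    2 * a 5 - 2 * a 6,
    2 * a 1 + 2 * a 4 + 2 * a 5 - 2 * a 6 - 2 * a 7 + 2,
    -2 * a 0 + 2 * a 2,
    -2 * a 5 + 2 * a 6,
    -2 * a 5 + 2 * a 6 + 2 * a 7 + 2,
    -2 * a 2 + 2 * a 4,
    2 * a 1 + 2 * a 5 - 2 * a 7 + 2,
    -2 * a 1 - 2 * a 2 + 2 * a 3 + 2 * a 4 - 2 * a 5 + 2 * a 6 + 2 * a 7 + 2,
    -2 * a 1 - 2 * a 2 + 2 * a 6 + 2 * a 7 + 2,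
    2 * a 1 + 2 * a 2 - 2 * a 3 + 2 * a 5 - 2 * a 7 + 2,
    2 * a 2 - 2 * a 4,
    2 * a 2 + 2 * a 5 - 2 * a 7 + 2,
    2 * a 0 + 2 * a 1 - 2 * a 3 - 2 * a 7,
    -2 * a 5 + 2 * a 7,
    2 * a 0 - 2 * a 2 + 2 * a 4 + 2,
    2 * a 3 + 2,
    2 * a 0 - 2 * a 2 + 2 * a 4 + 2,
    2 * a 2 + 2,
    2 * a 4 + 2 * a 5 - 2 * a 6 - 2 * a 7,
    -2 * a 0 + 2 * a 1 + 2 * a 2 + 2 * a 5 - 2 * a 6 - 2 * a 7,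
    -2 * a 4 - 2 * a 5 + 2 * a 6 + 2 * a 7,
    2 * a 6 + 2,
    2 * a 1 - 2 * a 3 + 2 * a 5 - 2 * a 7,
    2 * a 6 + 2]

/-- No divisor outside `A_basic ∪ δ⁰` is polar (see `twoValBZ`). -/
def PolarWithinBasic (a : Fin 8 → ℤ) : Prop := ∀ x ∈ twoValBZ a, 0 ≤ x

/-- `PolarWithinBasic` is decidable. -/
instance (a : Fin 8 → ℤ) : Decidable (PolarWithinBasic a) := by unfold PolarWithinBasic; infer_instance

/-- The basic vector `(1,…,1)` lies in the sub-cone (sanity check of the transcription). -/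
theorem polarWithinBasic_ones : PolarWithinBasic (fun _ => 1) := by decide

/-- **The weight-certified sub-cone is thin**: `A(a) ⊆ A_basic` forces `a₁ = a₃ = a₅ = a₆ = a₇ = a₈ =: n` and
`a₂ = a₄ =: m` with `n ≤ m ≤ n + 1` and `n ≥ -1` (0-based indices below: `a 0 = a 2 = a 4 = a 5 = a 6 = a 7`, `a 1 = a 3`).
Kernel-checked from the 48 forms. -/
theorem polarWithinBasic_shape (a : Fin 8 → ℤ) (h : PolarWithinBasic a) :
    a 0 = a 2 ∧ a 2 = a 4 ∧ a 4 = a 5 ∧ a 5 = a 6 ∧ a 6 = a 7 ∧ a 1 = a 3 ∧ a 0 ≤ a 1 ∧ a 1 ≤ a 0 + 1 ∧ -1 ≤ a 0 := by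
  simp only [PolarWithinBasic, twoValBZ, List.forall_mem_cons] at h
  omega

/-- Converse: the two rays (basic family `m = n` and its companion `m = n + 1`, `n ≥ -1`) lie in the sub-cone. -/
theorem polarWithinBasic_of_shape (a : Fin 8 → ℤ)
    (h : a 0 = a 2 ∧ a 2 = a 4 ∧ a 4 = a 5 ∧ a 5 = a 6 ∧ a 6 = a 7 ∧ a 1 = a 3 ∧ a 0 ≤ a 1 ∧ a 1 ≤ a 0 + 1 ∧ -1 ≤ a 0) :
    PolarWithinBasic a := by
  obtain ⟨h0, h1, h2, h3, h4, h5, h6, h7, h8⟩ := h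
  simp only [PolarWithinBasic, twoValBZ, List.forall_mem_cons]
  repeat' constructor
  all_goals first | omega | simp

/-- The ζ(3)-free law on the weight-certified sub-cone (a COROLLARY of `BrownZudilin2022.decomposition`; motivic proof route:
Brown Cor. 8.2 + `gr^W_6 m(A_basic, δ⁰) = 0`, census/mw).  (Lane note, P2 g3: tagged `@[conjecture]` — a cell-minted
statement, proved below only CONDITIONALLY on the named fact; filed for fam-brown8 g3/g4 VERBATIM otherwise.) -/
@[conjecture] def BZSubconeZeta3Free : Prop :=
  ∀ a : Fin 8 → ℤ, BrownZudilin2022.Converges a → PolarWithinBasic a →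
    ∃ q r s : ℚ, BrownZudilin2022.cellularIntegral a =
      q * (2 * zetaValue 5 + 4 * zetaValue 3 * zetaValue 2) + r * zetaValue 2 + s

/-- The sub-cone law is a COROLLARY of the named fact `BrownZudilin2022.decomposition` ((4) for every convergent `a`);
the point of stating it separately is its independent MOTIVIC proof route (Brown Cor. 8.2 + the computed `gr^W_6 = 0`). -/
theorem bzSubconeZeta3Free_of_decomposition (h : BrownZudilin2022.decomposition) : BZSubconeZeta3Free := by
  intro a ha _
  obtain ⟨Phat, P, hI⟩ := h a ha
  refine ⟨(BrownZudilin2022.QOf a : ℚ), -4 * Phat, -2 * P, ?_⟩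
  rw [hI]
  push_cast
  ring

/-- **Maximal weight-certified divisor set `X*` for the Brown–Zudilin family** (gen 3, census/mw `bz_maxcert_basic.json`).
`X*` = the 73 boundary divisors (named by the side of the partition not containing guest 8)
`14 17 24 35 36 57 124 125 127 134 135 136 137 145 146 147 156 157 167 235 236 245 246 247 257 346 356 357 367 457 467 1235 1237 1245 1246 1247 1257 1345 1346 1347 1356 1357 1367 1457 1467 1567 2346 2356 2357 2456 2457 2467 3457 3567 12346 12347 12356 12357 12367 12457 12467 12567 13456 13457 13467 13567 14567 23457 23467 23567 24567 123457 134567`;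
it contains `A_basic` (39) and was obtained by greedy enlargement keeping `gr^W_6 H⁵(M̄_{0,8} ∖ X, δ⁰ ∖ X) = 0`, then verified
maximal among the 99 non-arc divisors (every further single divisor makes `gr^W_6 ≠ 0`).  Brown's Thm 8.1 applies with ANY divisor set
`A ⊇ Sing(η)` avoiding the faces of the cell, so every convergent `a` whose polar set lies inside `X*` gives a period of this ONE
mixed Tate motive without weight 6: `I(a)` is ζ(3)-free for a motivic reason.  `twoValOutsideXStar a` lists twice the valuations
along the 14 divisors outside `X* ∪ δ⁰` whose form is not identically zero (12 more are identically `0`). -/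
def twoValOutsideXStar (a : Fin 8 → ℤ) : List ℤ :=
  [2 * a 0 + 2,
    2 * a 1 + 2,
    2 * a 4 + 2,
    2 * a 5 + 2,
    2 * a 2 + 2,
    2 * a 0 + 2 * a 1 - 2 * a 7 + 2,
    2 * a 0 + 2 * a 4 + 4,
    -2 * a 1 + 2 * a 3 + 2 * a 7 + 2,
    2 * a 1 + 2 * a 4 + 2 * a 5 - 2 * a 6 - 2 * a 7 + 2,
    -2 * a 5 + 2 * a 6 + 2 * a 7 + 2,
    2 * a 1 + 2 * a 5 - 2 * a 7 + 2,
    2 * a 1 + 2 * a 2 - 2 * a 3 + 2 * a 5 - 2 * a 7 + 2,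
    2 * a 2 + 2 * a 5 - 2 * a 7 + 2,
    2 * a 0 - 2 * a 2 + 2 * a 4 + 2]

/-- No divisor outside `X* ∪ δ⁰` is polar at `a`. -/
def PolarWithinXStar (a : Fin 8 → ℤ) : Prop := ∀ x ∈ twoValOutsideXStar a, 0 ≤ x

/-- `PolarWithinXStar a` is decidable. -/
instance (a : Fin 8 → ℤ) : Decidable (PolarWithinXStar a) := by unfold PolarWithinXStar; infer_instance

/-- BZ's RECORD exponent vector `(8,16,10,15,12,16,18,13)` [BrownZudilin2022, Sect. 11] lies in the `X*`-region. -/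
theorem polarWithinXStar_record : PolarWithinXStar ![8, 16, 10, 15, 12, 16, 18, 13] := by decide

/-- So does the basic vector. -/
theorem polarWithinXStar_ones : PolarWithinXStar (fun _ => 1) := by decide

/-- The `X*`-region contains the (thin) `A_basic`-sub-cone. -/
theorem polarWithinXStar_of_basic (a : Fin 8 → ℤ) (h : PolarWithinBasic a) : PolarWithinXStar a := by
  have hs := polarWithinBasic_shape a h
  obtain ⟨h0, h1, h2, h3, h4, h5, h6, h7, h8⟩ := hs
  simp only [PolarWithinXStar, twoValOutsideXStar, List.forall_mem_cons]
  repeat' constructor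
  all_goals first | omega | simp

/-- The ζ(3)-free law on the `X*`-region (again a COROLLARY of `BrownZudilin2022.decomposition`; the content is the motivic proof
route via [Brown2016, Cor. 8.2] and the computed `gr^W_6 = 0`, census/mw).  (Lane note, P2 g3: tagged `@[conjecture]`,
as for `BZSubconeZeta3Free`.) -/
@[conjecture] def BZXStarZeta3Free : Prop :=
  ∀ a : Fin 8 → ℤ, BrownZudilin2022.Converges a → PolarWithinXStar a →
    ∃ q r s : ℚ, BrownZudilin2022.cellularIntegral a =
      q * (2 * zetaValue 5 + 4 * zetaValue 3 * zetaValue 2) + r * zetaValue 2 + s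

/-- The `X*`-region law is a COROLLARY of the named fact `BrownZudilin2022.decomposition`. -/
theorem bzXStarZeta3Free_of_decomposition (h : BrownZudilin2022.decomposition) : BZXStarZeta3Free := by
  intro a ha _
  obtain ⟨Phat, P, hI⟩ := h a ha
  refine ⟨(BrownZudilin2022.QOf a : ℚ), -4 * Phat, -2 * P, ?_⟩
  rw [hI]
  push_cast
  ring

/-! ### Symmetry cover of the live cone (gen 3) -/

/-- Twice the valuations of the BZ integrand along the 20 `σ`-arc divisors (`σ_f`; BZ coordinates, `gsat.py`).  All `< 0` = the vector is
LIVE (every face divisor of the integrand's simple-pole locus is polar; otherwise `gr^W_10 = 0` in every computed case and no ζ(5) can occur). -/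
def twoValSigmaF (a : Fin 8 → ℤ) : List ℤ :=
  [2 * a 1 - 2 * a 3 + 2 * a 5 - 2 * a 6 - 2 * a 7 - 2,
    -2 * a 0 - 2 * a 1 + 2 * a 3 - 2 * a 5 + 2 * a 7 - 2,
    -2 * a 1 - 2 * a 2 - 2 * a 5 + 2 * a 6 + 2 * a 7 - 2,
    -2 * a 1 - 2 * a 2 + 2 * a 7 - 2,
    -2 * a 7 - 2,
    2 * a 1 + 2 * a 2 - 2 * a 3 - 2 * a 4 - 2 * a 7 - 2,
    2 * a 0 - 2 * a 2 - 2 * a 3 - 2,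
    -2 * a 0 - 2 * a 6 - 2,
    -2 * a 0 + 2 * a 2 - 2 * a 4 - 2 * a 5 - 2,
    -2 * a 1 - 2 * a 2 + 2 * a 4 - 2,
    -2 * a 3 - 2 * a 4 - 2,
    -2 * a 1 - 2 * a 2 - 2 * a 5 + 2 * a 7 - 2,
    -2 * a 0 - 2 * a 1 - 2 * a 4 - 2 * a 5 + 2 * a 7 - 2,
    -2 * a 0 + 2 * a 1 + 2 * a 2 - 2 * a 4 - 2 * a 6 - 2 * a 7 - 2,
    -2 * a 3 + 2 * a 5 - 2 * a 7 - 2,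
    -2 * a 4 - 2 * a 5 - 2,
    -2 * a 0 + 2 * a 2 - 2 * a 4 - 2 * a 6 - 2,
    -2 * a 0 - 2 * a 1 - 2,
    -2 * a 4 - 2 * a 5 + 2 * a 7 - 2,
    -2 * a 0 + 2 * a 2 + 2 * a 5 - 2 * a 6 - 2 * a 7 - 2]

/-- `a` is live: all 20 `σ_f`-valuations are negative. -/
def LiveBZ (a : Fin 8 → ℤ) : Prop := ∀ x ∈ twoValSigmaF a, x ≤ -1

/-- `LiveBZ a` is decidable. -/
instance (a : Fin 8 → ℤ) : Decidable (LiveBZ a) := by unfold LiveBZ; infer_instance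

/-- The five generators `i₁, p₀₁, p₁₂, h, h'` of BZ's group `G ≅ S₇` [BrownZudilin2022, Sect. 7], as typed in the tree. -/
def applyGen (i : Fin 5) (a : Fin 8 → ℤ) : Fin 8 → ℤ :=
  match i with
  | ⟨0, _⟩ => BrownZudilin2022.genI1 a
  | ⟨1, _⟩ => BrownZudilin2022.genP01 a
  | ⟨2, _⟩ => BrownZudilin2022.genP12 a
  | ⟨3, _⟩ => BrownZudilin2022.genH a
  | _ => BrownZudilin2022.genH' a

/-- Apply a word in the generators, first letter first. -/
def applyWord : List (Fin 5) → (Fin 8 → ℤ) → (Fin 8 → ℤ)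
  | [], a => a
  | i :: w, a => applyWord w (applyGen i a)

/-- Every prefix of the word keeps the vector convergent (the form in which the tree types BZ's invariance (27):
`BrownZudilin2022.invariance_of_converges'`, per generator on common domains of convergence). -/
def ConvergentChain (w : List (Fin 5)) (a : Fin 8 → ℤ) : Prop :=
  ∀ k ∈ List.range (w.length + 1), BrownZudilin2022.Converges (applyWord (w.take k) a)

/-- `ConvergentChain w a` is decidable. -/
instance (w : List (Fin 5)) (a : Fin 8 → ℤ) : Decidable (ConvergentChain w a) := by unfold ConvergentChain; infer_instance

/-- **Symmetry cover of the live cone, group-element form** (gen 3).  Status: THEOREM-BY-COMPUTATION — an exact polyhedral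
cover (census/mw/bz_exactcover3.json: 7 sign patterns, 2960 exact rational LPs with Chvátal–Gomory row rounding, 11 group elements;
merged with two partial runs: bz_exactcover_merged.json; randomized re-validation 41455/41455, bz_cover_validate.json) shows that EVERY
live convergent integer vector `a` has a word `w` (a group element `g ∈ G ≅ S₇`) with `g·a` convergent and inside the `X*`-region.
NOT kernel-proved (hence the tag).  With BZ's invariance (27) of `I(a)/∏_{i∈F} h_i(a)!` under the GROUP `G` [BrownZudilin2022, Sect. 7,
(27)] and [Brown2016, Cor. 8.2] for `X*` (`gr^W_6 = 0`, census/mw) this gives 'ζ(3) drops out' for every live BZ vector WITHOUT the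
explicit decomposition (4).  (The tree types (27) per generator on common convergence domains, `invariance_of_converges'`; for a
general `g` with `a`, `g·a` convergent it follows by analytic continuation in the exponents from the `G`-fixed ray `(n,…,n)` — a remark
of this census, not a typed fact; the chain form below is the one that needs only the typed statement.) -/
@[conjecture] def XStarOrbitCoverG : Prop :=
  ∀ a : Fin 8 → ℤ, BrownZudilin2022.Converges a → LiveBZ a →
    ∃ w : List (Fin 5), BrownZudilin2022.Converges (applyWord w a) ∧ PolarWithinXStar (applyWord w a)

/-- **Symmetry cover, chain form** (gen 3; status: OBSERVED — 750/750 sampled live vectors of the residual regions reach the `X*`-region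
through a chain of `≤ 4` generators with every intermediate vector convergent, census/mw/bz_sympath.json; open as typed). -/
@[conjecture] def XStarOrbitCover : Prop :=
  ∀ a : Fin 8 → ℤ, BrownZudilin2022.Converges a → LiveBZ a →
    ∃ w : List (Fin 5), ConvergentChain w a ∧ PolarWithinXStar (applyWord w a)

/-- The chain form implies the group-element form (the last link of a convergent chain is convergent). -/
theorem xStarOrbitCoverG_of_chain (h : XStarOrbitCover) : XStarOrbitCoverG := by
  intro a hc hl
  obtain ⟨w, hch, hp⟩ := h a hc hl
  refine ⟨w, ?_, hp⟩
  have := hch w.length (by simp)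
  simpa using this

/-- A live vector of the residual region where `D_1236` is polar (census/mw `bz_regsample_1236.jsonl`, own `gr^W_6 = 1`): it is NOT in the
`X*`-region … -/
theorem residual_example_not_within : ¬ PolarWithinXStar ![5, 6, 19, 4, 18, 20, 24, 21] := by decide

/-- … it is live and convergent … -/
theorem residual_example_live : LiveBZ ![5, 6, 19, 4, 18, 20, 24, 21] ∧ BrownZudilin2022.Converges ![5, 6, 19, 4, 18, 20, 24, 21] := by
  constructor <;> decide

/-- … and the chain `p₀₁ ∘ i₁` (both steps convergent) carries it to `(18,4,7,18,5,24,20,11)`, inside the `X*`-region (kernel-checked). -/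
theorem residual_example_covered :
    ConvergentChain [0, 1] ![5, 6, 19, 4, 18, 20, 24, 21] ∧ PolarWithinXStar (applyWord [0, 1] ![5, 6, 19, 4, 18, 20, 24, 21]) := by
  constructor <;> decide

end Summit.KontsevichZagierPeriods.Zeta5Search.Families.Cellular

end
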